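import Summits.KontsevichZagierPeriods.Zeta5Search.DualSeriesDenominators
import HarnessLib

/-!
# ζ(5) search — Zudilin's Lemma 19 denominators for the dual series `F̃₇(b)` (cell `pub-zeta5`, P1)

HONEST FRAMING: systematic search; no irrationality claim unless certified.

OUR instantiation (Summit side) of a PRINTED lemma — W. Zudilin, *Arithmetic of linear forms involving odd zeta
values*, J. Théor. Nombres Bordeaux 16 (2004), §8, Lemma 19 with (8.6)–(8.12) [cite: Zudilin2004, §8 Lemma 19] —
on OUR object, the canonical partial-fraction coefficients `U = coeffU`, `W = coeffW`, `V = coeffV` of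
Brown–Zudilin's dual very-well-poised series `F̃₇(b)` (`WedgeDictionary`, `DualSeriesDecomposition`); it refines
the typer's `DualSeriesDenominators` (`d_{b₀}`, `d_{b₀}³`, `d_{b₀}⁶`) to Zudilin's WINDOW exponents.

Zudilin's grouping (8.7) of the summand `R_b(t) = numPoly_b(t+1)/((t+1)_{b₀+1})⁶` (here `r = 1`, `q = 7`,
`h₀ = b₀ + 2`, `h_j = b_j + 1`): every slot `j = 2,…,7` is SELF-paired,
`(t+1)_{b_j}(t+b₀−b_j+2)_{b_j}/(t+1)_{b₀+1} = 1/(t+1+b_j)_{b₀+1−2b_j}` — a reciprocal brick whose poles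
`t = −(p+1)` all lie in the window `σ ≤ p ≤ b₀ − σ` as soon as `σ ≤ b_j` (`2b_j ≤ b₀`) — while slot 1 and the
very-well-poised factor `2t + b₀ + 2` stay POLYNOMIAL (integer linear factors).  Running the tree's brick calculus
(`BallRivoal.exists_pf_prod`, `PFSteps.linSteps`) in the SHIFTED variable `t' = t + σ` (poles `p' = p − σ ≤ b₀ − 2σ`)
therefore needs only a common multiple `d` of `1,…,b₀ − 2σ` (Zudilin's `m₀ = h₀ − 2h₂` at `σ = b₍₂₎`), and gives
(`exists_window_data`), with the normaliser `Ñ(b) = ∏_{j=2}^{7} (b₀ − 2b_j)!` (Zudilin's (8.6) without the division by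
`(b₁!)²`; `normaliser19`):

* `d^{5−o}·Ñ(b)·c_{o,p} ∈ ℤ` for THE partial-fraction data `c` of `R_b` (`o < 6`, `p ≤ b₀`);
* SUPPORT: `c_{o,p} = 0` unless `σ ≤ p ≤ b₀ − σ`;
* VANISHING: `Σ_{o,p} Ñ c_{o,p}/(p − i)^{o+1} = 0` for `i < b₁ ≤ σ` — `R_b` vanishes at `t = −1,…,−b₁` (the polynomial
  brick `(t+1)_{b₁}`), points at which the window expansion has no pole; this is how Zudilin starts the sum (8.6) at
  `t = 1 − h₁` and why his constant term carries the SHORTER harmonic sums `H_{k−h₁}`.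

Consequences (THEOREMS in the companion file `DualSeriesLemma19Coeffs.lean`): for `b` in the box with `Σ_j b_j ≤ 3b₀ + 1`, `b₁ ≤ σ ≤ b_j`, `2b_j ≤ b₀` (`j ≥ 2`):
* `coeffU_den19`: `d·Ñ(b)·U(b) ∈ ℤ`,  `coeffW_den19`: `d³·Ñ(b)·W(b) ∈ ℤ`  (`d` a common multiple of `1..b₀−2σ`) —
  Zudilin's (8.10) `D_{m₀}^{q−j} B_{jk} ∈ ℤ` summed over `k`;
* `coeffV_shift`: `Ñ·V(b) = Σ_{o,p} Ñ c_{o,p} · H_{p−b₁}^{(o+1)}` (the harmonic index shift of (8.12));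
* `coeffV_den19`: `d⁶·Ñ(b)·V(b) ∈ ℤ` for `d` a common multiple of `1..b₀−σ−b₁` (Zudilin's `m₁ = h₀ − h₁ − h₂` at
  `σ = b₍₂₎`).
NOT done here (stated precisely): Lemma 19's ORDER-DEPENDENT windows `c_{o,p} = 0` unless `b₍ₒ₊₂₎ ≤ p ≤ b₀ − b₍ₒ₊₂₎`,
which sharpen the constant term from `D_{m₁}⁶` to `D_{m₁}D_{m₂}⋯D_{m₆}`, `m_j = max{m₀, b₀ − b₍₁₎ − b₍₁₊ⱼ₎}`
(record direction `(41;17,…,11)·n`: `108n` here versus Zudilin's `103n`, versus the tree's `246n`), and the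
prime-by-prime factor `Φ` of (8.8)–(8.9).  Slot symmetry (`coeffU_swap`, …) moves the polynomial slot anywhere.
-/

noncomputable section

open Finset Polynomial
open Literature.NumberTheory.Transcendental
open Literature.NumberTheory.Transcendental.BallRivoal

namespace Summit.KontsevichZagierPeriods.Zeta5Search

namespace DualSeriesLemma19

open DualSeries WedgeDictionary PFSteps DualSeriesDenominators

/-! ### The self-paired grouping (Zudilin 2004, (8.7)) -/

/-- Window length `L_j = b₀ + 1 − 2b_j` of the self-paired slot `j`. -/
def wlen (b : ℕ → ℤ) (j : ℕ) : ℕ := bn b 0 + 1 - 2 * bn b j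

/-- **The normaliser** `Ñ(b) = ∏_{j=2}^{7} (b₀ − 2b_j)!` ((8.6) of Zudilin 2004 without the division by `(b₁!)²`). -/
def normaliser19 (b : ℕ → ℤ) : ℕ := ∏ s ∈ range 6, (wlen b (s + 2) - 1).factorial

/-- Middle block `m_j = (t+1+b_j)_{L_j}` of the self-paired slot `j`. -/
def mF (b : ℕ → ℤ) (t : ℚ) (j : ℕ) : ℚ := poch (t + 1 + bn b j) (wlen b j)

/-- The self-paired factorisation of the block: `(t+1)_{b₀+1} = f_j · m_j · s_j` (`2b_j ≤ b₀`). -/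
theorem block_eq_self {b : ℕ → ℤ} {j : ℕ} (h2 : 2 * bn b j ≤ bn b 0) (t : ℚ) :
    poch (t + 1) (bn b 0 + 1) = fF b t j * mF b t j * sF b t j := by
  have hsplit : bn b 0 + 1 = bn b j + (wlen b j + bn b j) := by unfold wlen; omega
  have hX : t + 1 + ((bn b j : ℕ) : ℚ) + ((wlen b j : ℕ) : ℚ) = t + 1 + (((bn b 0 : ℕ) : ℚ) - (bn b j : ℕ) + 1) := by
    have e : ((wlen b j : ℕ) : ℚ) = (bn b 0 : ℚ) + 1 - 2 * (bn b j : ℚ) := by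
      unfold wlen
      rw [Nat.cast_sub (by omega)]
      push_cast
      ring
    rw [e]; ring
  rw [hsplit, poch_add, poch_add, fF, mF, sF, hX, mul_assoc]

/-- Regrouping `Ñ·(ℓ·∏_j f_j s_j)/P⁶` into `(ℓ f₁ s₁)·∏_{j≥2} Ñ_j/m_j` given the six self-pairings `P = f_j m_j s_j`. -/
theorem regroup7 {K : Type*} [Field K]
    (ℓ f1 f2 f3 f4 f5 f6 f7 s1 s2 s3 s4 s5 s6 s7 m2 m3 m4 m5 m6 m7 N2 N3 N4 N5 N6 N7 P : K)
    (h2 : P = f2 * m2 * s2) (h3 : P = f3 * m3 * s3) (h4 : P = f4 * m4 * s4)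
    (h5 : P = f5 * m5 * s5) (h6 : P = f6 * m6 * s6) (h7 : P = f7 * m7 * s7)
    (hm2 : m2 ≠ 0) (hm3 : m3 ≠ 0) (hm4 : m4 ≠ 0) (hm5 : m5 ≠ 0) (hm6 : m6 ≠ 0) (hm7 : m7 ≠ 0)
    (hP : P ≠ 0) :
    (N2 * N3 * N4 * N5 * N6 * N7) *
        ((ℓ * ((f1 * s1) * (f2 * s2) * (f3 * s3) * (f4 * s4) * (f5 * s5) * (f6 * s6) * (f7 * s7))) / P ^ 6)
      = (ℓ * f1 * s1) * ((N2 / m2) * (N3 / m3) * (N4 / m4) * (N5 / m5) * (N6 / m6) * (N7 / m7)) := by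
  have hf2 : f2 ≠ 0 := by intro h; apply hP; rw [h2, h]; ring
  have hs2 : s2 ≠ 0 := by intro h; apply hP; rw [h2, h]; ring
  have hf3 : f3 ≠ 0 := by intro h; apply hP; rw [h3, h]; ring
  have hs3 : s3 ≠ 0 := by intro h; apply hP; rw [h3, h]; ring
  have hf4 : f4 ≠ 0 := by intro h; apply hP; rw [h4, h]; ring
  have hs4 : s4 ≠ 0 := by intro h; apply hP; rw [h4, h]; ring
  have hf5 : f5 ≠ 0 := by intro h; apply hP; rw [h5, h]; ring
  have hs5 : s5 ≠ 0 := by intro h; apply hP; rw [h5, h]; ring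
  have hf6 : f6 ≠ 0 := by intro h; apply hP; rw [h6, h]; ring
  have hs6 : s6 ≠ 0 := by intro h; apply hP; rw [h6, h]; ring
  have hf7 : f7 ≠ 0 := by intro h; apply hP; rw [h7, h]; ring
  have hs7 : s7 ≠ 0 := by intro h; apply hP; rw [h7, h]; ring
  have hP6 : P ^ 6 = (f2 * m2 * s2) * (f3 * m3 * s3) * (f4 * m4 * s4) * (f5 * m5 * s5) * (f6 * m6 * s6)
      * (f7 * m7 * s7) := by rw [← h2, ← h3, ← h4, ← h5, ← h6, ← h7]; ring
  rw [hP6]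
  field_simp

/-- (E2') The normaliser as a product of six factorials (cast). -/
theorem cast_normaliser19 (b : ℕ → ℤ) :
    (normaliser19 b : ℚ) = ((wlen b 2 - 1).factorial : ℚ) * ((wlen b 3 - 1).factorial : ℚ)
      * ((wlen b 4 - 1).factorial : ℚ) * ((wlen b 5 - 1).factorial : ℚ)
      * ((wlen b 6 - 1).factorial : ℚ) * ((wlen b 7 - 1).factorial : ℚ) := by
  rw [normaliser19]
  push_cast
  simp only [prod_range_succ, prod_range_zero, one_mul]

/-! ### The window: bricks and linear factors in the shifted variable `t' = t + σ` -/

/-- The top pole index of the window in the shifted variable: `n' = b₀ − 2σ`. -/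
def wtop (b : ℕ → ℤ) (σ : ℕ) : ℕ := bn b 0 - 2 * σ

/-- Residues of the six self-paired bricks, re-indexed to the window (`s`-th brick ↔ slot `s + 2`). -/
def brickW (b : ℕ → ℤ) (σ : ℕ) : ℕ → ℕ → ℤ := fun s => subRes (bn b (s + 2) - σ) (wlen b (s + 2))

/-- The integer linear factors in `t'`: `2t' + (b₀ + 2 − 2σ)`, `t' + (1 − σ + i)` and `t' + (b₀ − b₁ + 2 − σ + i)`
(`i < b₁`) — i.e. `2t + b₀ + 2`, `(t+1)_{b₁}`, `(t + b₀ − b₁ + 2)_{b₁}` at `t = t' − σ`. -/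
def linFactorsW (b : ℕ → ℤ) (σ : ℕ) : List (ℤ × ℤ) :=
  ((2 : ℤ), (bn b 0 : ℤ) + 2 - 2 * σ) ::
    (((List.range (bn b 1)).map fun i : ℕ => ((1 : ℤ), ((1 : ℤ) - σ) + (i : ℤ)))
      ++ ((List.range (bn b 1)).map fun i : ℕ => ((1 : ℤ), ((bn b 0 : ℤ) - bn b 1 + 2 - σ) + (i : ℤ))))

/-- (E4') The `s`-th window brick is the self-paired block of slot `s+2`: for `t'` off the window poles,
`brickEval n' (brickW b σ s) t' = (L−1)!/m_{s+2}(t' − σ)`. -/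
theorem brickW_eq {b : ℕ → ℤ} {σ : ℕ} (hσ : ∀ s, s < 6 → σ ≤ bn b (s + 2))
    (h2 : ∀ s, s < 6 → 2 * bn b (s + 2) ≤ bn b 0) (t' : ℚ)
    (ht : ∀ p, p ≤ wtop b σ → t' + p + 1 ≠ 0) (s : ℕ) (hs : s < 6) :
    brickEval (wtop b σ) (brickW b σ s) t' = (((wlen b (s + 2) - 1).factorial : ℕ) : ℚ) / mF b (t' - σ) (s + 2) := by
  have hσs := hσ s hs
  have h2s := h2 s hs
  rw [brickW, mF, ← subBlock_eq_brickEval (wtop b σ) (bn b (s + 2) - σ) (wlen b (s + 2))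
    (by unfold wlen; omega) (by unfold wlen wtop; omega) t' ht]
  congr 1
  rw [Nat.cast_sub hσs]
  ring

/-- (E5') The linear factors multiply to `ℓ · f₁ · s₁` at `t = t' − σ`. -/
theorem linProd_linFactorsW (b : ℕ → ℤ) (σ : ℕ) (t' : ℚ) :
    linProd (linFactorsW b σ) t' = ell b (t' - σ) * fF b (t' - σ) 1 * sF b (t' - σ) 1 := by
  rw [linFactorsW, linProd, List.map_cons, List.prod_cons, ← linProd, linProd_append, linProd_range,
    linProd_range, ell, fF, sF]
  push_cast
  have e1 : t' + ((1 : ℚ) - σ) = t' - σ + 1 := by ring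
  have e2 : t' + (((bn b 0 : ℕ) : ℚ) - (bn b 1 : ℕ) + 2 - σ) = t' - σ + 1 + ((bn b 0 : ℚ) - bn b 1 + 1) := by ring
  rw [e1, e2]
  ring

/-- **The product identity in the window variable**: for `t = t' − σ` off all poles,
`Ñ(b) · numPoly_b(t+1)/((t+1)_{b₀+1})⁶ = linProd(t') · ∏_{s<6} brickEval n' (brickW b σ s) t'`. -/
theorem normaliser19_mul_eq {b : ℕ → ℤ} {σ : ℕ} (hb : InBox b)
    (hσ : ∀ s, s < 6 → σ ≤ bn b (s + 2)) (h2 : ∀ s, s < 6 → 2 * bn b (s + 2) ≤ bn b 0) (t' : ℚ)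
    (ht : ∀ p, p ≤ bn b 0 → (t' - σ) + p + 1 ≠ 0) :
    (normaliser19 b : ℚ) * (((numPoly b).comp (X + C 1)).eval (t' - σ) / poch (t' - σ + 1) (bn b 0 + 1) ^ 6)
      = linProd (linFactorsW b σ) t' * ∏ s ∈ range 6, brickEval (wtop b σ) (brickW b σ s) t' := by
  have h2σ : 2 * σ ≤ bn b 0 := by have := hσ 0 (by norm_num); have := h2 0 (by norm_num); omega
  have ht' : ∀ p, p ≤ wtop b σ → t' + p + 1 ≠ 0 := by
    intro p hp h
    apply ht (p + σ) (by unfold wtop at hp; omega)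
    push_cast; linarith
  have hPne := poch_block_ne_zero (bn b 0) (t' - σ) ht
  have hm : ∀ s, s < 6 → mF b (t' - σ) (s + 2) ≠ 0 := by
    intro s hs h
    apply hPne
    rw [block_eq_self (h2 s hs) (t' - σ), h, mul_zero, zero_mul]
  rw [numerator_eq hb, cast_normaliser19, linProd_linFactorsW]
  simp only [prod_range_succ, prod_range_zero, one_mul]
  rw [brickW_eq hσ h2 t' ht' 0 (by norm_num), brickW_eq hσ h2 t' ht' 1 (by norm_num),
    brickW_eq hσ h2 t' ht' 2 (by norm_num), brickW_eq hσ h2 t' ht' 3 (by norm_num),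
    brickW_eq hσ h2 t' ht' 4 (by norm_num), brickW_eq hσ h2 t' ht' 5 (by norm_num)]
  exact regroup7 (ell b (t' - σ)) (fF b (t' - σ) 1) (fF b (t' - σ) 2) (fF b (t' - σ) 3) (fF b (t' - σ) 4)
    (fF b (t' - σ) 5) (fF b (t' - σ) 6) (fF b (t' - σ) 7)
    (sF b (t' - σ) 1) (sF b (t' - σ) 2) (sF b (t' - σ) 3) (sF b (t' - σ) 4) (sF b (t' - σ) 5)
    (sF b (t' - σ) 6) (sF b (t' - σ) 7)
    (mF b (t' - σ) 2) (mF b (t' - σ) 3) (mF b (t' - σ) 4) (mF b (t' - σ) 5) (mF b (t' - σ) 6) (mF b (t' - σ) 7)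
    _ _ _ _ _ _ _
    (block_eq_self (h2 0 (by norm_num)) _) (block_eq_self (h2 1 (by norm_num)) _)
    (block_eq_self (h2 2 (by norm_num)) _) (block_eq_self (h2 3 (by norm_num)) _)
    (block_eq_self (h2 4 (by norm_num)) _) (block_eq_self (h2 5 (by norm_num)) _)
    (hm 0 (by norm_num)) (hm 1 (by norm_num)) (hm 2 (by norm_num)) (hm 3 (by norm_num))
    (hm 4 (by norm_num)) (hm 5 (by norm_num)) hPne

/-! ### Extending window data to the full pole range -/

/-- Window data `e` (poles `p' ≤ n'` in `t'`) placed at `p = p' + σ` (zero outside the window). -/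
def extendW (σ n' : ℕ) (e : ℕ → ℕ → ℚ) : ℕ → ℕ → ℚ :=
  fun o p => if σ ≤ p ∧ p ≤ σ + n' then e o (p - σ) else 0

/-- Re-indexing: `pfEval N K (extendW σ n' e) t = pfEval n' K e (t + σ)` whenever `σ + n' ≤ N`. -/
theorem pfEval_extendW (σ n' N K : ℕ) (h : σ + n' ≤ N) (e : ℕ → ℕ → ℚ) (t : ℚ) :
    pfEval N K (extendW σ n' e) t = pfEval n' K e (t + σ) := by
  unfold pfEval
  rw [← sum_subset (s₁ := (range (n' + 1)).image (fun p' => p' + σ)) (s₂ := range (N + 1))]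
  · rw [sum_image (fun x _ y _ hxy => by simpa using hxy)]
    refine sum_congr rfl fun p' hp' => sum_congr rfl fun o _ => ?_
    have hp'' := mem_range.1 hp'
    have hw : σ ≤ p' + σ ∧ p' + σ ≤ σ + n' := ⟨by omega, by omega⟩
    simp only [extendW, if_pos hw, show p' + σ - σ = p' by omega]
    push_cast
    ring
  · intro p hp
    rw [mem_image] at hp
    obtain ⟨p', hp', rfl⟩ := hp
    have := mem_range.1 hp'
    exact mem_range.2 (by omega)
  · intro p _ hp
    have hp' : ¬ (σ ≤ p ∧ p ≤ σ + n') := by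
      intro hc
      exact hp (mem_image.2 ⟨p - σ, mem_range.2 (by omega), by omega⟩)
    refine sum_eq_zero fun o _ => ?_
    simp only [extendW, if_neg hp', zero_div]

/-! ### THE partial-fraction data through the window -/

/-- **Window expansion of THE partial-fraction data of `R_b`.**  On the box with `Σ_j b_j ≤ 3b₀ + 1`, if
`σ ≤ b_j` and `2b_j ≤ b₀` for `j = 2,…,7` and `b₁ ≤ σ`, then for every common multiple `d` of `1,…,b₀ − 2σ`:
THE data `c` of `R_b` satisfy `d^{5−o} Ñ(b) c_{o,p} ∈ ℤ`, vanish off the window `σ ≤ p ≤ b₀ − σ`, and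
`Σ_{o,p} Ñ c_{o,p}/(p − i)^{o+1} = 0` for every `i < b₁` (`R_b(−i−1) = 0`). -/
theorem exists_window_data {b : ℕ → ℤ} (hb : InBox b) (hsum : ∑ j ∈ range 7, b (j + 1) ≤ 3 * b 0 + 1)
    {σ : ℕ} (hσ : ∀ s, s < 6 → σ ≤ bn b (s + 2)) (h2 : ∀ s, s < 6 → 2 * bn b (s + 2) ≤ bn b 0)
    (h1 : bn b 1 ≤ σ)
    (d : ℕ) (hdiv : ∀ k : ℕ, 1 ≤ k → k ≤ wtop b σ → (k : ℤ) ∣ d) :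
    ∃ c : ℕ → ℕ → ℚ, IsPFData b c ∧
      (∀ o p, o < 6 → p ≤ bn b 0 → ∃ z : ℤ, (d : ℚ) ^ (5 - o) * ((normaliser19 b : ℚ) * c o p) = z) ∧
      (∀ o p, o < 6 → p ≤ bn b 0 → ¬ (σ ≤ p ∧ p ≤ σ + wtop b σ) → c o p = 0) ∧
      (∀ i : ℕ, i < bn b 1 →
        pfEval (bn b 0) 6 (fun o p => (normaliser19 b : ℚ) * c o p) (-((i : ℚ) + 1)) = 0) := by
  have h2σ : 2 * σ ≤ bn b 0 := by have := hσ 0 (by norm_num); have := h2 0 (by norm_num); omega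
  have hwin : σ + wtop b σ ≤ bn b 0 := by unfold wtop; omega
  obtain ⟨c₀, hc₀, hint₀, -⟩ := exists_pf_prod (wtop b σ) d hdiv (brickW b σ) 6 (by norm_num)
  have hc₁s : ∀ o p, 6 ≤ o → trunc 6 c₀ o p = 0 := fun o p ho => trunc_of_le ho p
  set e : ℕ → ℕ → ℚ := linSteps (linFactorsW b σ) (trunc 6 c₀) with he_def
  set Q : ℚ[X] := polyPart (wtop b σ) (linFactorsW b σ) (trunc 6 c₀) with hQ_def
  have hint₂ : IsInt 6 d e := isInt_linSteps hc₁s (isInt_trunc hint₀) _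
  -- evaluation of the window data off the WINDOW poles
  have heval : ∀ t' : ℚ, (∀ p, p ≤ wtop b σ → t' + p + 1 ≠ 0) →
      pfEval (wtop b σ) 6 e t' + Q.eval t' =
        linProd (linFactorsW b σ) t' * ∏ s ∈ range 6, brickEval (wtop b σ) (brickW b σ s) t' := by
    intro t' ht'
    have h1 := pfEval_linSteps (wtop b σ) 6 hc₁s t' ht' (linFactorsW b σ)
    rw [pfEval_trunc, hc₀ t' ht'] at h1
    exact h1
  obtain ⟨c, hc⟩ := exists_isPFData b hb hsum
  set ê : ℕ → ℕ → ℚ := extendW σ (wtop b σ) e with hê_def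
  -- the identity at the naturals
  have hnat : ∀ k : ℕ, 0 ≤ k →
      pfEval (bn b 0) 6 (fun o p => ê o p - (normaliser19 b : ℚ) * c o p) k
        + (Q.comp (X + C (σ : ℚ))).eval (k : ℚ) = 0 := by
    intro k _
    have hk : ∀ p, p ≤ bn b 0 → (k : ℚ) + p + 1 ≠ 0 := fun p _ => by positivity
    have hk' : ∀ p, p ≤ wtop b σ → ((k : ℚ) + σ) + p + 1 ≠ 0 := fun p _ => by positivity
    have hks : ∀ p, p ≤ bn b 0 → ((k : ℚ) + σ - σ) + p + 1 ≠ 0 := fun p _ => by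
      rw [add_sub_cancel_right]; positivity
    have E1 : pfEval (bn b 0) 6 ê k = pfEval (wtop b σ) 6 e ((k : ℚ) + σ) := pfEval_extendW _ _ _ _ hwin e _
    have E2 := heval ((k : ℚ) + σ) hk'
    have E3 := normaliser19_mul_eq hb hσ h2 ((k : ℚ) + σ) hks
    rw [add_sub_cancel_right] at E3
    have E4 : pfEval (bn b 0) 6 c k
        = ((numPoly b).comp (X + C 1)).eval (k : ℚ) / poch ((k : ℚ) + 1) (bn b 0 + 1) ^ 6 := hc (k : ℚ) hk
    rw [pfEval_sub', pfEval_const_mul, E4, E1]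
    rw [← E3] at E2
    simp only [eval_comp, eval_add, eval_X, eval_C] at E2 ⊢
    linear_combination E2
  obtain ⟨hQ0, hzero⟩ := pf_unique_poly (bn b 0) 6 _ _ 0 hnat
  have hê_eq : ∀ o p, o < 6 → p ≤ bn b 0 → ê o p = (normaliser19 b : ℚ) * c o p := by
    intro o p ho hp
    have := hzero o p ho hp
    linarith
  refine ⟨c, hc, ?_, ?_, ?_⟩
  · -- integrality
    intro o p ho hp
    rw [← hê_eq o p ho hp, hê_def, extendW]
    by_cases hw : σ ≤ p ∧ p ≤ σ + wtop b σ
    · rw [if_pos hw]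
      obtain ⟨z, hz⟩ := hint₂ o (p - σ)
      exact ⟨z, by rw [← hz, show (6 : ℕ) - 1 - o = 5 - o by omega]⟩
    · rw [if_neg hw, mul_zero]
      exact ⟨0, by simp⟩
  · -- support
    intro o p ho hp hw
    have h := hê_eq o p ho hp
    rw [hê_def, extendW, if_neg hw] at h
    have hN : (normaliser19 b : ℚ) ≠ 0 := by
      rw [normaliser19]; exact_mod_cast (prod_ne_zero_iff.2 fun s _ => Nat.factorial_ne_zero _)
    have := mul_eq_zero.1 h.symm
    exact this.resolve_left hN
  · -- vanishing at t = -(i+1), i < b₁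
    intro i hi
    have hdata : pfEval (bn b 0) 6 (fun o p => (normaliser19 b : ℚ) * c o p) (-((i : ℚ) + 1))
        = pfEval (bn b 0) 6 ê (-((i : ℚ) + 1)) := by
      unfold pfEval
      refine sum_congr rfl fun p hp => sum_congr rfl fun o ho => ?_
      rw [hê_eq o p (mem_range.1 ho) (Nat.lt_succ_iff.1 (mem_range.1 hp))]
    have hreg : ∀ p, p ≤ wtop b σ → (-((i : ℚ) + 1) + σ) + p + 1 ≠ 0 := by
      intro p _
      have : ((i : ℚ) + 1) ≤ (σ : ℚ) := by exact_mod_cast (show i + 1 ≤ σ by omega)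
      intro h
      have hp0 : (0 : ℚ) ≤ p := by positivity
      linarith
    have E2 := heval (-((i : ℚ) + 1) + σ) hreg
    have hlin : linProd (linFactorsW b σ) (-((i : ℚ) + 1) + σ) = 0 := by
      rw [linFactorsW, linProd, List.map_cons, List.prod_cons, List.map_append, List.prod_append]
      have hmem : ((1 : ℤ), ((1 : ℤ) - σ) + (i : ℤ)) ∈
          (List.range (bn b 1)).map fun i : ℕ => ((1 : ℤ), ((1 : ℤ) - σ) + (i : ℤ)) :=
        List.mem_map.2 ⟨i, List.mem_range.2 hi, rfl⟩
      have hz : (((List.range (bn b 1)).map fun i : ℕ => ((1 : ℤ), ((1 : ℤ) - σ) + (i : ℤ))).map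
          fun ab : ℤ × ℤ => (ab.1 : ℚ) * (-((i : ℚ) + 1) + σ) + ab.2).prod = 0 := by
        apply List.prod_eq_zero
        refine List.mem_map.2 ⟨_, hmem, ?_⟩
        push_cast; ring
      rw [hz]; ring
    have hQ : Q.eval (-((i : ℚ) + 1) + σ) = 0 := by
      have : (Q.comp (X + C (σ : ℚ))).eval (-((i : ℚ) + 1)) = Q.eval (-((i : ℚ) + 1) + σ) := by
        simp only [eval_comp, eval_add, eval_X, eval_C]
      rw [← this, hQ0, eval_zero]
    rw [hdata, hê_def, pfEval_extendW _ _ _ _ hwin]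
    rw [hQ, add_zero, hlin, zero_mul] at E2
    exact E2

end DualSeriesLemma19

end Summit.KontsevichZagierPeriods.Zeta5Search
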